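import Mathlib
import Literature.Analysis.FluidPDE.SelfSimilar
import HarnessLib

/-!
# RootDecompPointVertex — crux GAP `QuietShellGap` (stmt-NavierStokesRegularity-31112), stub `stub_quietParabolicExterior`

Registered stub (writer g10 first-prover skeleton, 2026-08-30T21:3xZ; lens-4 g9 «THE QUIET SHELL», plan step S2
«quiet annulus ⟹ quiet PARABOLIC exterior by the DSS ladder both ways»), PROVED here verbatim:
for a rotated discretely self-similar field `U` (`λ R⁻¹ U(λ²t, λRx) = U(t,x)`, `λ = c > 1`), smallness of the
similarity amplitude `√(-t) |U(t,x)|` on the annulus `1 ≤ |x| ≤ c` over a final time window `s₀ ≤ t < 0` propagates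
to the whole parabolic exterior `|x| ≥ K √(-t)`, `t < 0`, with `K = c / √(-s₀)`.

Proof: `Q(t,x) = √(-t)|U(t,x)|` is invariant under the DSS step `(t,x) ↦ (c²t, cRx)` and its inverse; iterate the step
(up if `|x| < 1`, down if `|x| ≥ 1`, `exists_nat_pow_near`) until the space point lands in the annulus; the parabolic
exterior condition is exactly what keeps the rescaled time inside `[s₀, 0)`. Pure algebra; no PDE.
Decoration toward S (a stratum of a support-grade crux); Navier–Stokes regularity is NOT proved by anything here (rung 0).
-/

-- the summit and its single sub-problem share the name (CONVENTIONS §1), as in every Theorems file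
set_option linter.dupNamespace false

open Literature.Analysis.FluidPDE

namespace Summit.NavierStokesRegularity.NavierStokesRegularity.Theorems.QuietShellGap

/-- **The DSS ladder** for the similarity amplitude: if `|U(t,x)| = d |U(d²t, Sx)|` with `|Sx| = d|x|` (`d > 0`), then
for every `n`, `√(-t)|U(t,x)| = √(-(d^{2n}t)) |U(d^{2n}t, y)|` for some `y` with `|y| = dⁿ|x|`. [folklore] -/
theorem ladder {U : ℝ → EuclideanSpace ℝ (Fin 3) → EuclideanSpace ℝ (Fin 3)} {d : ℝ} (hd : 0 < d)
    (S : EuclideanSpace ℝ (Fin 3) → EuclideanSpace ℝ (Fin 3)) (hS : ∀ x, ‖S x‖ = d * ‖x‖)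
    (hstep : ∀ t x, ‖U t x‖ = d * ‖U (d ^ 2 * t) (S x)‖) :
    ∀ n : ℕ, ∀ (t : ℝ) (x : EuclideanSpace ℝ (Fin 3)), ∃ y : EuclideanSpace ℝ (Fin 3), ‖y‖ = d ^ n * ‖x‖ ∧
      Real.sqrt (-t) * ‖U t x‖ = Real.sqrt (-(d ^ (2 * n) * t)) * ‖U (d ^ (2 * n) * t) y‖ := by
  intro n
  induction n with
  | zero => intro t x; exact ⟨x, by simp, by simp⟩
  | succ n ih =>
    intro t x
    obtain ⟨y, hy, hq⟩ := ih t x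
    refine ⟨S y, ?_, ?_⟩
    · rw [hS, hy, pow_succ]; ring
    · have e1 : d ^ 2 * (d ^ (2 * n) * t) = d ^ (2 * (n + 1)) * t := by ring
      have e2 : Real.sqrt (-(d ^ (2 * (n + 1)) * t)) = d * Real.sqrt (-(d ^ (2 * n) * t)) := by
        rw [show -(d ^ (2 * (n + 1)) * t) = d ^ 2 * (-(d ^ (2 * n) * t)) by ring,
          Real.sqrt_mul (by positivity) _, Real.sqrt_sq hd.le]
      rw [hq, hstep (d ^ (2 * n) * t) y, e1, e2]
      ring

/-- **Registered stub `stub_quietParabolicExterior`** of crux `QuietShellGap` (stmt-NavierStokesRegularity-31112), verbatim: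
a quiet annulus on a final window forces a quiet parabolic exterior for a rotated DSS field (lens-4 g9 plan step S2;
DSS ladder both ways). [folklore] -/
theorem stub_quietParabolicExterior : ∀ (δ c s₀ : ℝ) (R : EuclideanSpace ℝ (Fin 3) ≃ₗᵢ[ℝ] EuclideanSpace ℝ (Fin 3)) (U : ℝ → EuclideanSpace ℝ (Fin 3) → EuclideanSpace ℝ (Fin 3)), 1 < c → Literature.Analysis.FluidPDE.IsRotatedDSS c R U → s₀ < 0 → (∀ t : ℝ, s₀ ≤ t → t < 0 → ∀ x : EuclideanSpace ℝ (Fin 3), 1 ≤ ‖x‖ → ‖x‖ ≤ c → Real.sqrt (-t) * ‖U t x‖ ≤ δ) → ∃ K : ℝ, 0 < K ∧ ∀ t : ℝ, t < 0 → ∀ x : EuclideanSpace ℝ (Fin 3), K * Real.sqrt (-t) ≤ ‖x‖ → Real.sqrt (-t) * ‖U t x‖ ≤ δ := by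
  intro δ c s₀ R U hc hdss hs₀ hann
  have hc0 : 0 < c := by linarith
  -- the DSS step in norm form, up and down
  have hup : ∀ t x, ‖U t x‖ = c * ‖U (c ^ 2 * t) (c • R x)‖ := by
    intro t x
    rw [← hdss t x, norm_smul, LinearIsometryEquiv.norm_map, Real.norm_of_nonneg hc0.le]
  have hdown : ∀ t x, ‖U t x‖ = c⁻¹ * ‖U (c⁻¹ ^ 2 * t) (c⁻¹ • R.symm x)‖ := by
    intro t x
    have h := hup (c⁻¹ ^ 2 * t) (c⁻¹ • R.symm x)
    have h1 : c ^ 2 * (c⁻¹ ^ 2 * t) = t := by field_simp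
    have h2 : c • R (c⁻¹ • R.symm x) = x := by
      rw [R.map_smul, smul_smul, mul_inv_cancel₀ hc0.ne', one_smul, R.apply_symm_apply]
    rw [h1, h2] at h
    rw [h, ← mul_assoc, inv_mul_cancel₀ hc0.ne', one_mul]
  have hSup : ∀ x : EuclideanSpace ℝ (Fin 3), ‖c • R x‖ = c * ‖x‖ := fun x => by
    rw [norm_smul, LinearIsometryEquiv.norm_map, Real.norm_of_nonneg hc0.le]
  have hSdown : ∀ x : EuclideanSpace ℝ (Fin 3), ‖c⁻¹ • R.symm x‖ = c⁻¹ * ‖x‖ := fun x => by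
    rw [norm_smul, LinearIsometryEquiv.norm_map, Real.norm_of_nonneg (inv_pos.2 hc0).le]
  -- the constant
  set S₀ : ℝ := Real.sqrt (-s₀) with hS₀
  have hS₀pos : 0 < S₀ := Real.sqrt_pos.2 (by linarith)
  have hS₀sq : S₀ ^ 2 = -s₀ := Real.sq_sqrt (by linarith)
  refine ⟨c / S₀, div_pos hc0 hS₀pos, fun t ht x hx => ?_⟩
  have hst : 0 < Real.sqrt (-t) := Real.sqrt_pos.2 (by linarith)
  have hstsq : Real.sqrt (-t) ^ 2 = -t := Real.sq_sqrt (by linarith)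
  have hxpos : 0 < ‖x‖ := lt_of_lt_of_le (mul_pos (div_pos hc0 hS₀pos) hst) hx
  -- `c √(-t) ≤ S₀ ‖x‖`
  have hkey : c * Real.sqrt (-t) ≤ S₀ * ‖x‖ := by
    have := mul_le_mul_of_nonneg_left hx hS₀pos.le
    calc c * Real.sqrt (-t) = S₀ * (c / S₀ * Real.sqrt (-t)) := by field_simp
      _ ≤ S₀ * ‖x‖ := this
  rcases le_or_gt 1 ‖x‖ with hx1 | hx1
  · -- `‖x‖ ≥ 1`: go DOWN the ladder `n` times, `c^n ≤ ‖x‖ < c^(n+1)`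
    obtain ⟨n, hn1, hn2⟩ := exists_nat_pow_near hx1 hc
    obtain ⟨y, hy, hq⟩ := ladder (inv_pos.2 hc0) (fun x => c⁻¹ • R.symm x) hSdown hdown n t x
    have hcn : 0 < c ^ n := pow_pos hc0 n
    have hinv : c⁻¹ ^ n = (c ^ n)⁻¹ := inv_pow c n
    have hinv2 : c⁻¹ ^ (2 * n) = ((c ^ n) ^ 2)⁻¹ := by rw [inv_pow, pow_mul, ← pow_mul, mul_comm, pow_mul]
    -- the rescaled point is in the annulus
    have hy1 : 1 ≤ ‖y‖ := by
      rw [hy, hinv, le_inv_mul_iff₀ hcn, mul_one]; exact hn1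
    have hy2 : ‖y‖ ≤ c := by
      rw [hy, hinv, inv_mul_le_iff₀ hcn]
      have : c ^ (n + 1) = c ^ n * c := pow_succ c n
      linarith [hn2]
    -- the rescaled time is in the window
    set t' : ℝ := c⁻¹ ^ (2 * n) * t with ht'
    have ht'neg : t' < 0 := mul_neg_of_pos_of_neg (pow_pos (inv_pos.2 hc0) _) ht
    have ht'win : s₀ ≤ t' := by
      -- `√(-t) < c^n S₀` from `c √(-t) ≤ S₀ ‖x‖ < S₀ c^(n+1)`
      have h1 : Real.sqrt (-t) < c ^ n * S₀ := by
        have h2 : c * Real.sqrt (-t) < S₀ * c ^ (n + 1) :=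
          hkey.trans_lt (mul_lt_mul_of_pos_left hn2 hS₀pos)
        rw [pow_succ] at h2
        nlinarith
      have h3 : -t < (c ^ n) ^ 2 * (-s₀) := by
        rw [← hstsq, ← hS₀sq, ← mul_pow]
        exact pow_lt_pow_left₀ h1 hst.le two_ne_zero
      have h4 : -t' = ((c ^ n) ^ 2)⁻¹ * (-t) := by rw [ht', hinv2]; ring
      have h5 : ((c ^ n) ^ 2)⁻¹ * (-t) < -s₀ := by
        rw [inv_mul_lt_iff₀ (by positivity)]; exact h3
      linarith
    have := hann t' ht'win ht'neg y hy1 hy2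
    rwa [ht', ← hq] at this
  · -- `‖x‖ < 1`: go UP the ladder `n + 1` times, `c^n ≤ ‖x‖⁻¹ < c^(n+1)`
    have hxi : 1 ≤ ‖x‖⁻¹ := (one_le_inv₀ hxpos).2 hx1.le
    obtain ⟨n, hn1, hn2⟩ := exists_nat_pow_near hxi hc
    obtain ⟨y, hy, hq⟩ := ladder hc0 (fun x => c • R x) hSup hup (n + 1) t x
    have hcn : 0 < c ^ n := pow_pos hc0 n
    -- the rescaled point is in the annulus
    have hy1 : 1 ≤ ‖y‖ := by
      rw [hy]
      have : ‖x‖⁻¹ * ‖x‖ = 1 := inv_mul_cancel₀ hxpos.ne'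
      nlinarith [mul_le_mul_of_nonneg_right hn2.le hxpos.le]
    have hy2 : ‖y‖ ≤ c := by
      rw [hy, pow_succ]
      have h1 : c ^ n * ‖x‖ ≤ 1 := by
        have := mul_le_mul_of_nonneg_right hn1 hxpos.le
        rwa [inv_mul_cancel₀ hxpos.ne'] at this
      nlinarith
    -- the rescaled time is in the window
    set t' : ℝ := c ^ (2 * (n + 1)) * t with ht'
    have ht'neg : t' < 0 := mul_neg_of_pos_of_neg (pow_pos hc0 _) ht
    have ht'win : s₀ ≤ t' := by
      -- `c^(n+1) √(-t) ≤ S₀` from `c √(-t) ≤ S₀ ‖x‖` and `c^n ‖x‖ ≤ 1`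
      have h1 : c ^ n * ‖x‖ ≤ 1 := by
        have := mul_le_mul_of_nonneg_right hn1 hxpos.le
        rwa [inv_mul_cancel₀ hxpos.ne'] at this
      have h2 : c ^ (n + 1) * Real.sqrt (-t) ≤ S₀ := by
        calc c ^ (n + 1) * Real.sqrt (-t) = c ^ n * (c * Real.sqrt (-t)) := by rw [pow_succ]; ring
          _ ≤ c ^ n * (S₀ * ‖x‖) := mul_le_mul_of_nonneg_left hkey hcn.le
          _ = S₀ * (c ^ n * ‖x‖) := by ring
          _ ≤ S₀ * 1 := mul_le_mul_of_nonneg_left h1 hS₀pos.le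
          _ = S₀ := mul_one _
      have h3 : (c ^ (n + 1)) ^ 2 * (-t) ≤ -s₀ := by
        rw [← hstsq, ← hS₀sq, ← mul_pow]
        exact pow_le_pow_left₀ (by positivity) h2 2
      have h4 : -t' = (c ^ (n + 1)) ^ 2 * (-t) := by rw [ht', pow_mul, ← pow_mul, mul_comm 2, pow_mul]; ring
      linarith
    have := hann t' ht'win ht'neg y hy1 hy2
    rwa [ht', ← hq] at this

end Summit.NavierStokesRegularity.NavierStokesRegularity.Theorems.QuietShellGap
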